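/-
Copyright (c) 2026 the pub-hodgecm-mathlib formalisation cell (harness21).  Prover seat hodgecm-mathlib-F0P2-p06 (g12): road «S3-ram» (LEAD F0P3a-plan (g12); architect
A-p16 (g31); owner F0P3a-p06 (g15)), organ A′ (ii) J6 «LOCAL LAW IN ENGINE SHAPE», part J6-mult: the PREDICATE-WEIGHTED fixed-grandchildren count (ED. 2 of ★ G3⁺);
2026-09-02.
-/
import Literature.NumberTheory.Automorphic.UnitaryLatticeTreeFixedGrandchildrenCountRamified   -- ★ p847297 (this seat): G3⁺, the rooted fixed-grandchildren count
import HarnessLib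

/-!
# The lattice graph of a hermitian space — THE FIXED GRANDCHILDREN OF A FIXED SELF-DUAL VERTEX CUT BY A SLICE-CONSTANT LABEL: `#{w ∈ GC(v) : P w} = q · #{children
# passing along which P holds}` (Kottwitz 1986 §3; Serre, *Trees* I.2.3, II.1.1; Bruhat–Tits 1972 §10)

Topic `NumberTheory/Automorphic`; namespace `Literature.NumberTheory.Automorphic.UnitaryLatticeTree`.  THEOREMS ONLY (no definition, no instance, no notation, no named fact,
no `sorry`); kernel lane `--supports stmt-HodgeConjecture-24833`.  Cell `pub/hodgecm-mathlib` (D-0151), crux H413; road «S3-ram» (Literature seeding), organ A′ (ii) of the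
P-1-ram skeleton (architect A-p16 (g31)), junction gap **J6** of F0P3a-p01 (g16)'s J-PACK (23:57:42Z): the tree-induction engine `strataVec_cone_eq_of_localLaw` asks, at a
fixed self-dual vertex `v ≠ r`, not only for `#GC(v)` (★ G3⁺ `ncard_fixedGrandchildren_eq_mul_ncard_passingChildren`) but for the LABELLED pieces
`#{w ∈ GC(v) : dep w = …, cl w = …}` (binders `hO`, and the label clauses of `hR hE hP`).  The labels of the (a2) sheet are functions of the CHILD LINE only — they are
constant along each slice `{w ~ c : dist(r,w) = dist(r,c)+1}` through a child `c` of `v` (★ FILE H `UnitaryLatticeTreeFixedChildTokensRamified`, F0P2-p01 (g15): the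
tokens of the `q` children `κ·(N₁ ⊔ 𝒪w(a,b))` through the line `x̄ = κe₀` do not see the lift `b`).  THIS FILE proves the corresponding count, ED. 2 of ★ G3⁺ with a
predicate: for ANY slice-constant `P`,
  **`#{w ∈ GC(v) : P w} = q · #{c child of v : c passes ∧ P holds along the slice of c}`**
(same hypotheses as ★ G3⁺: `hT`, `v` self-dual `≠ r`, fixed, LEVEL token `ϖ`; `P` and its slice-constancy `hP` are binders).  With `P := ⊤` it is ★ G3⁺; with `P := (dep · = d′)`,
`(cl · = s)` it is the multiplicity half of `hO`∕`hE`∕`hP`, the other factor `#{children … }` being a count of residual LINES (★ G3′ p847330 ∕ G3″ p847343 for «passes»,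
FILE H for the label along the line).

HONEST LABEL: HC_CM is proved only modulo the 2 remaining named inputs (hLiu418 24832, h413 24833) until rung 0 closes; nothing printed is asserted here (rooted-tree
bookkeeping over ★ results); «S3-ram» has no books consequence.

## References
* [Kottwitz1986] R. E. Kottwitz, *Base change for unit elements of Hecke algebras*, Compositio Math. 60 (1986), §3 (counting fixed lattices shell by shell, by type).
* [Serre1980Trees] J.-P. Serre, *Trees* (1980), Ch. I §2.3 (rooted trees), Ch. II §1.1 (neighbours of a lattice; fixed subtrees).
* [BruhatTits1972] F. Bruhat, J. Tits, *Groupes réductifs sur un corps local I*, Publ. Math. IHÉS 41 (1972), §10.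
* [Tits1979] J. Tits, *Reductive groups over local fields*, PSPM 33.1 (1979), §2.4, §3.5.
-/

set_option autoImplicit false

noncomputable section

open scoped Valued WithZero Matrix MatrixGroups

namespace Literature.NumberTheory.Automorphic.UnitaryLatticeTree

open Literature.NumberTheory.Automorphic Literature.NumberTheory.Automorphic.HermitianLattice
open Literature.NumberTheory.Automorphic.CartanUnique
open Literature.Combinatorics.SimpleGraph.TreeLayers

variable {K : Type*} [Field K] [Valued K ℤᵐ⁰] {σ : K →+* K} {ϖ : K}

/-- The `ncard` of a finite pairwise-disjoint union indexed by a finset is the sum of the `ncard`s (folklore bookkeeping, as in ★ G1∕G3⁺). [cite: Serre1980Trees, I.2.3] -/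
private theorem ncard_biUnion_finset_eq_sum_of_disjoint_G3sep {ι α : Type*} [DecidableEq ι] (I : Finset ι) (S : ι → Set α)
    (hfin : ∀ i ∈ I, (S i).Finite) (hdisj : ∀ i ∈ I, ∀ j ∈ I, i ≠ j → Disjoint (S i) (S j)) :
    (⋃ i ∈ I, S i).ncard = ∑ i ∈ I, (S i).ncard := by
  induction I using Finset.induction_on with
  | empty => simp
  | insert a I haI ih =>
    have hfin' : ∀ i ∈ I, (S i).Finite := fun i hi => hfin i (Finset.mem_insert_of_mem hi)
    have hdisj' : ∀ i ∈ I, ∀ j ∈ I, i ≠ j → Disjoint (S i) (S j) := fun i hi j hj =>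
      hdisj i (Finset.mem_insert_of_mem hi) j (Finset.mem_insert_of_mem hj)
    rw [Finset.set_biUnion_insert, Finset.sum_insert haI, ← ih hfin' hdisj']
    refine Set.ncard_union_eq ?_ (hfin a (Finset.mem_insert_self a I)) (Set.Finite.biUnion I.finite_toSet hfin')
    rw [Set.disjoint_iUnion₂_right]
    exact fun i hi => hdisj a (Finset.mem_insert_self a I) i (Finset.mem_insert_of_mem hi) (fun h => haI (h ▸ hi))

section Three

/-- **`#{w ∈ GC(v) : P w} = q · #{children of v passing along which P holds}`** for every SLICE-CONSTANT predicate `P` (constant on the vertices one step beyond each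
child of `v`): ED. 2 of ★ G3⁺ `ncard_fixedGrandchildren_eq_mul_ncard_passingChildren` — the slice through a child `c` contributes its `q` fixed vertices when `c` passes
and `P` holds along it, and nothing otherwise (★ G3 all-or-none; slices are disjoint in the tree). [cite: Kottwitz1986, §3] [cite: Serre1980Trees, I.2.3, II.1.1]
[cite: Tits1979, §3.5] [cite: BruhatTits1972, §10] -/
theorem ncard_fixedGrandchildren_sep_eq_mul_ncard_passingChildren (hσ : ∀ x, σ (σ x) = x) (hvσ : ∀ a, Valued.v (σ a) = Valued.v a) (hσϖ : σ ϖ = -ϖ)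
    (hϖ : Valued.v ϖ = WithZero.exp (-1 : ℤ)) (hres : ∀ x : K, Valued.v x ≤ 1 → Valued.v (σ x - x) < 1) (h2 : Valued.v (2 : K) = 1) [Finite 𝓀[K]]
    (hT : (latticeGraph σ ϖ ((StdForm.antidiagonal 3).over K)).IsTree)
    {γ : unitaryGroupOfForm σ ((StdForm.antidiagonal 3).over K)}
    {v : {M : Submodule 𝒪[K] (Fin 3 → K) // IsVertex σ ϖ ((StdForm.antidiagonal 3).over K) M}}
    (hv : IsSelfDualLattice σ ϖ ((StdForm.antidiagonal 3).over K) v.1) (hvr : v ≠ ⟨stdLattice K 3, 0, isSelfDualLattice_stdLattice_three_of_v hϖ⟩)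
    (hfix : latticeGraphIso σ ϖ ((StdForm.antidiagonal 3).over K) γ v = v)
    (hlev : v.1.map ((Matrix.toLin' (((γ : GL (Fin 3) K) : Matrix (Fin 3) (Fin 3) K) - 1)).restrictScalars 𝒪[K]) ≤ scaleLattice ϖ v.1)
    (P : {M : Submodule 𝒪[K] (Fin 3 → K) // IsVertex σ ϖ ((StdForm.antidiagonal 3).over K) M} → Prop)
    (hP : ∀ c, (latticeGraph σ ϖ ((StdForm.antidiagonal 3).over K)).Adj v c →
      (latticeGraph σ ϖ ((StdForm.antidiagonal 3).over K)).dist ⟨stdLattice K 3, 0, isSelfDualLattice_stdLattice_three_of_v hϖ⟩ c = (latticeGraph σ ϖ ((StdForm.antidiagonal 3).over K)).dist ⟨stdLattice K 3, 0, isSelfDualLattice_stdLattice_three_of_v hϖ⟩ v + 1 →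
      ∀ w w', (latticeGraph σ ϖ ((StdForm.antidiagonal 3).over K)).Adj c w → (latticeGraph σ ϖ ((StdForm.antidiagonal 3).over K)).dist ⟨stdLattice K 3, 0, isSelfDualLattice_stdLattice_three_of_v hϖ⟩ w = (latticeGraph σ ϖ ((StdForm.antidiagonal 3).over K)).dist ⟨stdLattice K 3, 0, isSelfDualLattice_stdLattice_three_of_v hϖ⟩ c + 1 →
        (latticeGraph σ ϖ ((StdForm.antidiagonal 3).over K)).Adj c w' → (latticeGraph σ ϖ ((StdForm.antidiagonal 3).over K)).dist ⟨stdLattice K 3, 0, isSelfDualLattice_stdLattice_three_of_v hϖ⟩ w' = (latticeGraph σ ϖ ((StdForm.antidiagonal 3).over K)).dist ⟨stdLattice K 3, 0, isSelfDualLattice_stdLattice_three_of_v hϖ⟩ c + 1 → (P w ↔ P w')) :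
    {w | (∃ c, ((latticeGraph σ ϖ ((StdForm.antidiagonal 3).over K)).Adj v c ∧
          (latticeGraph σ ϖ ((StdForm.antidiagonal 3).over K)).dist ⟨stdLattice K 3, 0, isSelfDualLattice_stdLattice_three_of_v hϖ⟩ c =
            (latticeGraph σ ϖ ((StdForm.antidiagonal 3).over K)).dist ⟨stdLattice K 3, 0, isSelfDualLattice_stdLattice_three_of_v hϖ⟩ v + 1 ∧
          latticeGraphIso σ ϖ ((StdForm.antidiagonal 3).over K) γ c = c) ∧
        ((latticeGraph σ ϖ ((StdForm.antidiagonal 3).over K)).Adj c w ∧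
          (latticeGraph σ ϖ ((StdForm.antidiagonal 3).over K)).dist ⟨stdLattice K 3, 0, isSelfDualLattice_stdLattice_three_of_v hϖ⟩ w =
            (latticeGraph σ ϖ ((StdForm.antidiagonal 3).over K)).dist ⟨stdLattice K 3, 0, isSelfDualLattice_stdLattice_three_of_v hϖ⟩ c + 1 ∧
          latticeGraphIso σ ϖ ((StdForm.antidiagonal 3).over K) γ w = w)) ∧ P w}.ncard =
      Nat.card 𝓀[K] *
        {c | (latticeGraph σ ϖ ((StdForm.antidiagonal 3).over K)).Adj v c ∧
          (latticeGraph σ ϖ ((StdForm.antidiagonal 3).over K)).dist ⟨stdLattice K 3, 0, isSelfDualLattice_stdLattice_three_of_v hϖ⟩ c =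
            (latticeGraph σ ϖ ((StdForm.antidiagonal 3).over K)).dist ⟨stdLattice K 3, 0, isSelfDualLattice_stdLattice_three_of_v hϖ⟩ v + 1 ∧
          (∀ w ∈ (latticeGraph σ ϖ ((StdForm.antidiagonal 3).over K)).neighborSet c, latticeGraphIso σ ϖ ((StdForm.antidiagonal 3).over K) γ w = w) ∧
          ∀ w, (latticeGraph σ ϖ ((StdForm.antidiagonal 3).over K)).Adj c w → (latticeGraph σ ϖ ((StdForm.antidiagonal 3).over K)).dist ⟨stdLattice K 3, 0, isSelfDualLattice_stdLattice_three_of_v hϖ⟩ w = (latticeGraph σ ϖ ((StdForm.antidiagonal 3).over K)).dist ⟨stdLattice K 3, 0, isSelfDualLattice_stdLattice_three_of_v hϖ⟩ c + 1 → P w}.ncard := by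
  classical
  -- notation-free abbreviations
  set G := latticeGraph σ ϖ ((StdForm.antidiagonal 3).over K) with hG
  set r : {M : Submodule 𝒪[K] (Fin 3 → K) // IsVertex σ ϖ ((StdForm.antidiagonal 3).over K) M} :=
    ⟨stdLattice K 3, 0, isSelfDualLattice_stdLattice_three_of_v hϖ⟩ with hr
  have hϖ0 : ϖ ≠ 0 := uniformizer_ne_zero hϖ
  -- the rooted parent map
  obtain ⟨p, hpar, hchild, -, -⟩ := exists_rooted_parent hT r
  -- `v = u·L₀`, `γ′ = u⁻¹γu ∈ K₀`, `γ′ ≡ 1 (mod ϖ)`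
  obtain ⟨u, hu⟩ := exists_latticeGraphIso_root_eq_of_v_two hσ hvσ hϖ h2 v hv (isSelfDualLattice_stdLattice_three_of_v hϖ)
  subst hu
  have hγK : u⁻¹ * γ * u ∈ unitaryInt σ ((StdForm.antidiagonal 3).over K) := mem_unitaryInt_conj_of_latticeGraphIso_apply_root_eq hfix
  have hγϖ : ∀ i j, Valued.v (((((u⁻¹ * γ * u : unitaryGroupOfForm σ ((StdForm.antidiagonal 3).over K)) : GL (Fin 3) K) : Matrix (Fin 3) (Fin 3) K) - 1) i j) ≤ Valued.v ϖ :=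
    (forall_v_conj_sub_one_le_iff_map_sub_one_le_scaleLattice γ u hϖ0).1 hlev
  have hγ1 : ∀ i j, Valued.v (((((u⁻¹ * γ * u : unitaryGroupOfForm σ ((StdForm.antidiagonal 3).over K)) : GL (Fin 3) K) : Matrix (Fin 3) (Fin 3) K) - 1) i j) < 1 :=
    fun i j => lt_of_le_of_lt (hγϖ i j) (by rw [hϖ, ← WithZero.exp_zero]; exact WithZero.exp_lt_exp.2 (by norm_num))
  -- every neighbour of `v` is fixed
  have hnbfix : ∀ c ∈ G.neighborSet (latticeGraphIso σ ϖ ((StdForm.antidiagonal 3).over K) u r), latticeGraphIso σ ϖ ((StdForm.antidiagonal 3).over K) γ c = c :=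
    fun c hc => (latticeGraphIso_eq_iff_mapGL_eq γ c).2 (mapGL_eq_self_of_mem_neighborSet_latticeGraphIso_root_of_congr hσ hvσ hσϖ hϖ h2 hγK hγ1 hc)
  -- children: neighbours other than the parent
  have hvr' : latticeGraphIso σ ϖ ((StdForm.antidiagonal 3).over K) u r ≠ r := hvr
  have hchildren : ∀ c, (G.Adj (latticeGraphIso σ ϖ ((StdForm.antidiagonal 3).over K) u r) c ∧ G.dist r c = G.dist r (latticeGraphIso σ ϖ ((StdForm.antidiagonal 3).over K) u r) + 1) →
      c ≠ r ∧ p c = latticeGraphIso σ ϖ ((StdForm.antidiagonal 3).over K) u r := by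
    rintro c ⟨hadj, hdc⟩
    have hcp : c ≠ p (latticeGraphIso σ ϖ ((StdForm.antidiagonal 3).over K) u r) := by
      intro hcp
      have h := (hpar _ hvr').2
      rw [← hcp] at h
      omega
    refine ⟨fun hcr => ?_, (hchild _ c hvr' hadj hcp).2⟩
    rw [hcr, SimpleGraph.dist_self] at hdc
    omega
  -- the slice through a child `c`
  have hslice : ∀ c, (G.Adj (latticeGraphIso σ ϖ ((StdForm.antidiagonal 3).over K) u r) c ∧ G.dist r c = G.dist r (latticeGraphIso σ ϖ ((StdForm.antidiagonal 3).over K) u r) + 1) →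
      {w | G.Adj c w ∧ G.dist r w = G.dist r c + 1 ∧ latticeGraphIso σ ϖ ((StdForm.antidiagonal 3).over K) γ w = w} =
        {w | w ∈ G.neighborSet c ∧ w.1 ≠ mapGL (u : GL (Fin 3) K) (stdLattice K 3) ∧ mapGL (γ : GL (Fin 3) K) w.1 = w.1} := by
    rintro c ⟨hadj, hdc⟩
    obtain ⟨hcr, hpc⟩ := hchildren c ⟨hadj, hdc⟩
    ext w
    simp only [Set.mem_setOf_eq, SimpleGraph.mem_neighborSet]
    constructor
    · rintro ⟨hcw, hdw, hfw⟩
      refine ⟨hcw, fun heq => ?_, (latticeGraphIso_eq_iff_mapGL_eq γ w).1 hfw⟩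
      have hwv : w = latticeGraphIso σ ϖ ((StdForm.antidiagonal 3).over K) u r := Subtype.ext (by rw [latticeGraphIso_apply_val]; exact heq)
      rw [hwv] at hdw
      omega
    · rintro ⟨hcw, hne, hfw⟩
      have hwp : w ≠ p c := by
        rw [hpc]; intro hwv; apply hne; rw [hwv, latticeGraphIso_apply_val]
      exact ⟨hcw, (hchild c w hcr hcw hwp).1, (latticeGraphIso_eq_iff_mapGL_eq γ w).2 hfw⟩
  -- the slice count: `q` if `c` passes, `0` otherwise
  have hslicecount : ∀ c, (G.Adj (latticeGraphIso σ ϖ ((StdForm.antidiagonal 3).over K) u r) c ∧ G.dist r c = G.dist r (latticeGraphIso σ ϖ ((StdForm.antidiagonal 3).over K) u r) + 1) →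
      {w | G.Adj c w ∧ G.dist r w = G.dist r c + 1 ∧ latticeGraphIso σ ϖ ((StdForm.antidiagonal 3).over K) γ w = w}.ncard =
        if (∀ w ∈ G.neighborSet c, latticeGraphIso σ ϖ ((StdForm.antidiagonal 3).over K) γ w = w) then Nat.card 𝓀[K] else 0 := by
    rintro c ⟨hadj, hdc⟩
    rw [hslice c ⟨hadj, hdc⟩]
    obtain ⟨κ, hκK, rfl⟩ := (mem_neighborSet_latticeGraphIso_root_iff hσ hvσ hσϖ hϖ h2 u c).1 hadj
    rw [ncard_fixed_children_latticeGraphIso_eq_ite_forall hvσ hσϖ hϖ hres hγK hκK hγϖ]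
  -- finiteness of the star of `v`
  have hstarv : (G.neighborSet (latticeGraphIso σ ϖ ((StdForm.antidiagonal 3).over K) u r)).ncard = Nat.card 𝓀[K] + 1 := by
    rw [ncard_neighborSet_latticeGraphIso]
    exact ncard_neighborSet_root_of_ramified hσ hvσ hϖ hres h2 (isVertexLattice_two_N₁_of_neg hσϖ hϖ)
  have hfinv : (G.neighborSet (latticeGraphIso σ ϖ ((StdForm.antidiagonal 3).over K) u r)).Finite :=
    Set.finite_of_ncard_ne_zero (by rw [hstarv]; exact Nat.succ_ne_zero _)
  -- the slices through the children are finite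
  have hslicefin0 : ∀ c, (G.Adj (latticeGraphIso σ ϖ ((StdForm.antidiagonal 3).over K) u r) c ∧ G.dist r c = G.dist r (latticeGraphIso σ ϖ ((StdForm.antidiagonal 3).over K) u r) + 1) →
      {w | G.Adj c w ∧ G.dist r w = G.dist r c + 1 ∧ latticeGraphIso σ ϖ ((StdForm.antidiagonal 3).over K) γ w = w}.Finite := by
    rintro c ⟨hadj, hdc⟩
    rw [hslice c ⟨hadj, hdc⟩]
    obtain ⟨κ, hκK, rfl⟩ := (mem_neighborSet_latticeGraphIso_root_iff hσ hvσ hσϖ hϖ h2 u c).1 hadj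
    have hstarc : (G.neighborSet (latticeGraphIso σ ϖ ((StdForm.antidiagonal 3).over K) (u * κ) ⟨latt (Matrix.diagonal ![(1 : K), 1, ϖ]), 2, isVertexLattice_two_N₁_of_neg hσϖ hϖ⟩)).Finite :=
      Set.finite_of_ncard_ne_zero (by rw [ncard_neighborSet_latticeGraphIso, ncard_neighborSet_N₁_of_neg hvσ hσϖ hϖ hres]; exact Nat.succ_ne_zero _)
    exact hstarc.subset (fun w hw => hw.1)
  -- the `P`-slice count: `q` if `c` passes and `P` holds along the slice, `0` otherwise
  have hslicecountP : ∀ c, (G.Adj (latticeGraphIso σ ϖ ((StdForm.antidiagonal 3).over K) u r) c ∧ G.dist r c = G.dist r (latticeGraphIso σ ϖ ((StdForm.antidiagonal 3).over K) u r) + 1) →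
      {w | G.Adj c w ∧ G.dist r w = G.dist r c + 1 ∧ latticeGraphIso σ ϖ ((StdForm.antidiagonal 3).over K) γ w = w ∧ P w}.ncard =
        if ((∀ w ∈ G.neighborSet c, latticeGraphIso σ ϖ ((StdForm.antidiagonal 3).over K) γ w = w) ∧
            ∀ w, G.Adj c w → G.dist r w = G.dist r c + 1 → P w) then Nat.card 𝓀[K] else 0 := by
    rintro c ⟨hadj, hdc⟩
    have hsub : {w | G.Adj c w ∧ G.dist r w = G.dist r c + 1 ∧ latticeGraphIso σ ϖ ((StdForm.antidiagonal 3).over K) γ w = w ∧ P w} ⊆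
        {w | G.Adj c w ∧ G.dist r w = G.dist r c + 1 ∧ latticeGraphIso σ ϖ ((StdForm.antidiagonal 3).over K) γ w = w} :=
      fun w hw => ⟨hw.1, hw.2.1, hw.2.2.1⟩
    have hcount := hslicecount c ⟨hadj, hdc⟩
    by_cases hpass : ∀ w ∈ G.neighborSet c, latticeGraphIso σ ϖ ((StdForm.antidiagonal 3).over K) γ w = w
    · rw [if_pos hpass] at hcount
      by_cases hall : ∀ w, G.Adj c w → G.dist r w = G.dist r c + 1 → P w
      · rw [if_pos ⟨hpass, hall⟩, ← hcount]
        congr 1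
        ext w
        simp only [Set.mem_setOf_eq]
        exact ⟨fun h => ⟨h.1, h.2.1, h.2.2.1⟩, fun h => ⟨h.1, h.2.1, h.2.2, hall w h.1 h.2.1⟩⟩
      · rw [if_neg (fun h => hall h.2)]
        push Not at hall
        obtain ⟨w₁, hw₁, hdw₁, hPw₁⟩ := hall
        rw [Set.ncard_eq_zero ((hslicefin0 c ⟨hadj, hdc⟩).subset hsub)]
        ext w
        simp only [Set.mem_setOf_eq, Set.mem_empty_iff_false, iff_false, not_and]
        intro hcw hdw _ hPw
        exact hPw₁ ((hP c hadj hdc w w₁ hcw hdw hw₁ hdw₁).1 hPw)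
    · rw [if_neg (fun h => hpass h.1)]
      rw [if_neg hpass] at hcount
      have hempty := (Set.ncard_eq_zero (hslicefin0 c ⟨hadj, hdc⟩)).1 hcount
      rw [Set.ncard_eq_zero ((hslicefin0 c ⟨hadj, hdc⟩).subset hsub)]
      exact Set.eq_empty_of_subset_empty (hempty ▸ hsub)
  -- the children as a finset
  set CH := {c | G.Adj (latticeGraphIso σ ϖ ((StdForm.antidiagonal 3).over K) u r) c ∧ G.dist r c = G.dist r (latticeGraphIso σ ϖ ((StdForm.antidiagonal 3).over K) u r) + 1} with hCH
  have hCHfin : CH.Finite := hfinv.subset (fun c hc => hc.1)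
  set I := hCHfin.toFinset with hI
  have hmemI : ∀ c, c ∈ I ↔ G.Adj (latticeGraphIso σ ϖ ((StdForm.antidiagonal 3).over K) u r) c ∧ G.dist r c = G.dist r (latticeGraphIso σ ϖ ((StdForm.antidiagonal 3).over K) u r) + 1 :=
    fun c => by rw [hI, Set.Finite.mem_toFinset]; rfl
  -- the `P`-part of GC as a disjoint union of `P`-slices over the children
  have hunion : {w | (∃ c, (G.Adj (latticeGraphIso σ ϖ ((StdForm.antidiagonal 3).over K) u r) c ∧ G.dist r c = G.dist r (latticeGraphIso σ ϖ ((StdForm.antidiagonal 3).over K) u r) + 1 ∧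
          latticeGraphIso σ ϖ ((StdForm.antidiagonal 3).over K) γ c = c) ∧
        (G.Adj c w ∧ G.dist r w = G.dist r c + 1 ∧ latticeGraphIso σ ϖ ((StdForm.antidiagonal 3).over K) γ w = w)) ∧ P w} =
      ⋃ c ∈ I, {w | G.Adj c w ∧ G.dist r w = G.dist r c + 1 ∧ latticeGraphIso σ ϖ ((StdForm.antidiagonal 3).over K) γ w = w ∧ P w} := by
    ext w
    simp only [Set.mem_setOf_eq, Set.mem_iUnion, exists_prop]
    constructor
    · rintro ⟨⟨c, ⟨hadj, hdc, -⟩, hw⟩, hPw⟩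
      exact ⟨c, (hmemI c).2 ⟨hadj, hdc⟩, hw.1, hw.2.1, hw.2.2, hPw⟩
    · rintro ⟨c, hc, hcw, hdw, hfw, hPw⟩
      obtain ⟨hadj, hdc⟩ := (hmemI c).1 hc
      exact ⟨⟨c, ⟨hadj, hdc, hnbfix c hadj⟩, hcw, hdw, hfw⟩, hPw⟩
  have hdisj : ∀ c ∈ I, ∀ c' ∈ I, c ≠ c' →
      Disjoint {w | G.Adj c w ∧ G.dist r w = G.dist r c + 1 ∧ latticeGraphIso σ ϖ ((StdForm.antidiagonal 3).over K) γ w = w ∧ P w}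
        {w | G.Adj c' w ∧ G.dist r w = G.dist r c' + 1 ∧ latticeGraphIso σ ϖ ((StdForm.antidiagonal 3).over K) γ w = w ∧ P w} := by
    intro c hc c' hc' hne
    rw [Set.disjoint_left]
    rintro w ⟨hcw, hdw, -, -⟩ ⟨hc'w, hd'w, -, -⟩
    obtain ⟨hcr, -⟩ := hchildren c ((hmemI c).1 hc)
    obtain ⟨hc'r, -⟩ := hchildren c' ((hmemI c').1 hc')
    have hwpc : w ≠ p c := by
      intro hwp
      have h := (hpar c hcr).2
      rw [← hwp] at h
      omega
    have hwpc' : w ≠ p c' := by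
      intro hwp
      have h := (hpar c' hc'r).2
      rw [← hwp] at h
      omega
    exact hne (((hchild c w hcr hcw hwpc).2).symm.trans (hchild c' w hc'r hc'w hwpc').2)
  have hslicefin : ∀ c ∈ I, {w | G.Adj c w ∧ G.dist r w = G.dist r c + 1 ∧ latticeGraphIso σ ϖ ((StdForm.antidiagonal 3).over K) γ w = w ∧ P w}.Finite := by
    intro c hc
    exact (hslicefin0 c ((hmemI c).1 hc)).subset (fun w hw => ⟨hw.1, hw.2.1, hw.2.2.1⟩)
  -- sum the slices
  rw [hunion, ncard_biUnion_finset_eq_sum_of_disjoint_G3sep I _ hslicefin hdisj]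
  rw [Finset.sum_congr rfl (fun c hc => hslicecountP c ((hmemI c).1 hc))]
  rw [Finset.sum_ite, Finset.sum_const_zero, add_zero, Finset.sum_const, smul_eq_mul, mul_comm]
  congr 1
  rw [← Set.ncard_coe_finset]
  congr 1
  ext c
  simp only [Finset.coe_filter, Set.mem_setOf_eq, hmemI]
  exact ⟨fun ⟨⟨h1, h2'⟩, h3, h4⟩ => ⟨h1, h2', h3, h4⟩, fun ⟨h1, h2', h3, h4⟩ => ⟨⟨h1, h2'⟩, h3, h4⟩⟩

end Three

end Literature.NumberTheory.Automorphic.UnitaryLatticeTree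

end
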